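import Summits.QuantumFields.YangMills.Theorems.FemtoTransferGapLevelsDecay
import Summits.QuantumFields.YangMills.Theorems.LuscherReductionOneSiteLevelsAbsLower
import Summits.QuantumFields.YangMills.Theorems.LuscherReductionOneSiteLevelsValleyFar
import Literature.Analysis.OperatorTheory.YangMillsMatrixModelAL1Holds
import HarnessLib

/-!
# Route item `OneSiteTail` (stmt-QuantumFields-20204, support, M; child of RED `RunningReduction` stmt-QuantumFields-19978):
# TWO DOORS in min–max currency, over tree constants only — ideator-2 (crux-ideate levers (d)/(e)), rev 2 of the g10 stub-reading companion

Route `LuscherReduction` rev 11 split RED along the TT door of skeleton «KTR» rev 8; the one-site tail bound is now the route item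

  `OneSiteTail := ∀ s > 0, ∀ ε > 0, ∃ K B0, ∀ B ≥ B0, ∀ T : ℕ, s ≤ 2Tλ_b(B) → Summable (k ↦ x_k(B)^T) ∧ Σ_k x_{k+K}(B)^T ≤ ε`,
  `x_k(B) = levelValue su2Rep 1 B k / levelValue su2Rep 1 B 0`, `λ_b = bareLambda B = (2/B)^{1/3}` (stated below VERBATIM as `OneSiteTailBody`).

DOOR 1 (owner ym-beyond-p1 g18; IN THE TREE def-free since p511477, `Theorems/LuscherReductionRunningReductionOneSiteTailOfDomination.lean`,
`FemtoTransferGap.OSTail.oneSiteTail_of_domination`): `OneSiteDomination → OneSiteTailBody`, where `OneSiteDomination` asks `λ_k(B) ≤ e^{−λ_b g(k)} λ_0(B)`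
for ALL levels `k` and all `B ≥ B0`, `g` Laplace-summable.  For each FIXED `B` this forces `−log x_k(B) → ∞` faster than `log k` as `k → ∞` — the
deep-lattice regime of the one-site transfer operator (generic `SU(2)³`, lattice energies `≳ 1`, `k ≳ B^{9/2}`), whose only known proof is a
Peter–Weyl / heat-kernel eigenvalue count on `SU(2)³` composed with singular-value inequalities (neither is in Mathlib or the tree); the (HS) bound
below only gives `−log x_k(B) ≥ ½ log(k/(C B⁹))`, logarithmic growth in `k` at fixed `B`, whereas `λ_b(B)·g(k)` with `g` Laplace-summable (`Σ e^{−t g} < ∞`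
for EVERY `t > 0`) must eventually exceed every multiple of `log k`.

DOOR 2 (this file): the deep-lattice regime is NOT needed.  Two inputs:
 (HS) `OneSiteHSRatio`: `Σ_{j<n} x_j(B)² ≤ C·B⁹` uniformly in `B ≥ B0`, `n` — ★ PROVED here (`oneSiteHSRatio`) from tree theorems only: Bessel
      `sum_levelValue_sq_le`, the pointwise kernel bound `abs_transferKernel_le` (`K_B ≤ e^{6B}`), the Gaussian normaliser bound `gauss_le_linkCE`
      (`linkC(B)³ ≥ (1−27/B)e^{6B}√(π/B)⁹/(2π²)³`) and the CLOSED crux ONE at `k = 0` (`oneSiteAbsLower_of_eigenfunctions` + `LuscherHamiltonianEigenfunctions_holds`: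
      `λ_0 ≥ linkC³ e^{−ε λ_b − Cλ_b²}`);
 (TD) `OneSiteTruncatedDomination`: for every `c₁ > 0` a Laplace-summable profile `g ≥ 0` with `λ_k(B) ≤ e^{−λ_b·min(g(k), c₁ log B)} λ_0(B)` for all `k`,
      `B ≥ B0(c₁)` — domination only UP TO femto energy `c₁ log B` (deep inside the femto-clean zone `≲ B^{1/12}` of the toron valley), the threshold value
      `e^{−λ_b c₁ log B}` beyond (which by monotonicity in `k` is just the finiteness of the level count below that height).  `OneSiteDomination →
      OneSiteTruncatedDomination` trivially (`truncatedDomination_of_domination`), so door 2's hypothesis is WEAKER than door 1's.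
 ★ `oneSiteTail_of_hs_truncated : OneSiteHSRatio → OneSiteTruncatedDomination → OneSiteTailBody` (PROVED), hence
 ★ `oneSiteTail_of_truncatedDomination : OneSiteTruncatedDomination → OneSiteTailBody` and, as a corollary, the owner's `OneSiteDomination → OneSiteTailBody`.
Proof of the glue (`s, ε` given; `c₁ := 40/s`; `B` large, `Tλ_b ≥ s/2`, so `T ≥ 4` and `(T−2)λ_b ≥ s/4` once `λ_b ≤ s/8`):
`x_k^T ≤ e^{−(s/2) g(k)}` when `g(k) ≤ c₁ log B`, and `x_k^T = x_k²·x_k^{T−2} ≤ x_k²·B^{−c₁ s/4} = x_k² B^{−10}` otherwise; so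
`Σ_{k≥K} x_k^T ≤ Σ_{k≥K} e^{−(s/2)g(k)} + B^{−10}·C B⁹ ≤ ε/2 + C/B ≤ ε` (the power `T ≳ B^{1/3}` is what makes the weak threshold bite).
§4 THE CURRENCY OF (TD) — a femto-zone LEVEL COUNT (both conversions PROVED):
 `OneSiteLowCount`: `∀ c₁ > 0 ∃ C p B0, ∀ B ≥ B0, ∀ E ∈ [0, c₁ log B], ∀ k ≥ C(1+E)^p: λ_k(B) ≤ e^{−λ_b E} λ_0(B)` (the number of one-site zero-flux
 levels of femto energy `≤ E` is `≤ C(1+E)^p`, B-uniformly) ⟹ (TD) (`truncatedDomination_of_lowCount`, inverse profile `g(k) = (k/C)^{1/(p+1)} − 1`,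
 Laplace-summable by `x^m/m! ≤ e^x`); and its variational form `OneSiteFemtoSubspaceBound` (`n ≤ C(1+E)^p` physical constraint functions kill every
 Rayleigh quotient above `e^{−λ_b E} λ_0` — the hypothesis shape of the tree door `levelValue_le_of_forall_rayleigh_le`) ⟹ `OneSiteLowCount`
 (`lowCount_of_femtoSubspaceBound`).  ★ `oneSiteTail_of_lowCount`, ★ `oneSiteTail_of_femtoSubspaceBound`.

WHAT REMAINS for the M-seat on stmt-QuantumFields-20204 via door 2: ONE of `OneSiteFemtoSubspaceBound` / `OneSiteLowCount` / `OneSiteTruncatedDomination`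
— a B-uniform Weyl-type UPPER COUNT of the one-site zero-flux levels on the femto zone `E ≤ c₁ log B` only (IMS localisation along the toron valley of
`SU(2)³` + the matrix-model count below `E`, Literature `YangMillsMatrixModelDiscreteness` / `finrank_le_dimBound`, [cite: Simon1983, Thm 1.1]), with NO
input from the deep-lattice spectrum of `SU(2)³` (no Peter–Weyl, no heat-kernel count, no singular-value inequalities).  The conclusion `OneSiteTailBody` is
the route decl `Theses.LuscherReduction.OneSiteTail` verbatim (`Iff.rfl`, scratch `OneSiteTailIff.lean` of this seat), so a Theorems copy of this module
closes the item by `theorem … : Theses.LuscherReduction.OneSiteTail := oneSiteTail_of_femtoSubspaceBound h`.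
HONEST FRAMING: elementary real analysis + Courant–Fischer bookkeeping over tree constants; the count itself is NOT proved here; femto rung R2b1 only;
not infinite volume, not continuum, not Clay.  References: [cite: Luscher1983, §1]; [cite: LuscherMunster1984]; [cite: Simon1983, Thm 1.1];
[cite: ReedSimonIV1978, XIII.1]; [cite: ReedSimonI1980, Thm. VI.22]; [cite: MontvayMunster1994, §3.2.3].
-/

set_option autoImplicit false

noncomputable section

open Filter Topology Real
open Literature.MathematicalPhysics.QuantumFieldTheory
open Literature.MathematicalPhysics.QuantumLattice
open Literature.Analysis.OperatorTheory.YMMatrixModel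

namespace Summit.QuantumFields.YangMills.Theorems.FemtoTransferGap.OSTailDoors

/-! ## §0 The two statements of record, verbatim (defeq to the owner's `OSTail.OneSiteDomination` / `OSTail.OneSiteTailBody` and to the route decl
`Summit.QuantumFields.YangMills.Theses.LuscherReduction.OneSiteTail`, rev 11) -/

/-- **`OneSiteDomination`** (door 1 hypothesis, owner g18; verbatim): `λ_k(B) ≤ e^{−λ_b(B)·g(k)} λ_0(B)` for ALL `k` and `B ≥ B0`, `g ≥ 0`
Laplace-summable. [cite: Luscher1983, §1] [cite: Simon1983, Thm 1.1] -/
def OneSiteDomination : Prop :=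
  ∃ g : ℕ → ℝ, (∀ k, 0 ≤ g k) ∧ (∀ t : ℝ, 0 < t → Summable fun k : ℕ => Real.exp (-t * g k)) ∧
    ∃ B0 : ℝ, ∀ B : ℝ, B0 ≤ B → ∀ k : ℕ,
      levelValue su2Rep 1 B k ≤ Real.exp (-(bareLambda B * g k)) * levelValue su2Rep 1 B 0

/-- The body of the route item `OneSiteTail` (stmt-QuantumFields-20204) = registered stub `TT.OneSiteTail` of «KTR» rev 8, verbatim over tree constants.
[cite: Luscher1983, §1] -/
def OneSiteTailBody : Prop :=
  ∀ s : ℝ, 0 < s → ∀ ε : ℝ, 0 < ε → ∃ K : ℕ, ∃ B0 : ℝ, ∀ B : ℝ, B0 ≤ B → ∀ T : ℕ,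
    s ≤ 2 * ((T : ℝ) * bareLambda B) →
      Summable (fun k : ℕ => (levelValue su2Rep 1 B k / levelValue su2Rep 1 B 0) ^ T) ∧
      ∑' k : ℕ, (levelValue su2Rep 1 B (k + K) / levelValue su2Rep 1 B 0) ^ T ≤ ε

/-! ## §1 (HS) the polynomial Hilbert–Schmidt ratio — PROVED from the tree -/

/-- **`OneSiteHSRatio`** (door 2, input 1): `Σ_{j<n} x_j(B)² ≤ C·B⁹` for all `n` and all `B ≥ B0`. [cite: ReedSimonI1980, Thm. VI.22]
[cite: MontvayMunster1994, §3.2.3] -/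
def OneSiteHSRatio : Prop :=
  ∃ C B0 : ℝ, ∀ B : ℝ, B0 ≤ B → ∀ n : ℕ,
    ∑ j ∈ Finset.range n, (levelValue su2Rep 1 B j / levelValue su2Rep 1 B 0) ^ 2 ≤ C * B ^ 9

/-- `(√x ^ 9)² = x⁹` for `x ≥ 0`. [folklore] -/
theorem sqrt_pow_nine_sq {x : ℝ} (hx : 0 ≤ x) : (Real.sqrt x ^ 9) ^ 2 = x ^ 9 := by
  rw [← pow_mul, show 9 * 2 = 2 * 9 by norm_num, pow_mul, Real.sq_sqrt hx]

/-- ★ **(HS) holds**: `Σ_{j<n} x_j(B)² ≤ C·B⁹` uniformly in `B ≥ B0`.  Bessel (`sum_levelValue_sq_le`) with the pointwise bound `K_B ≤ e^{6B}`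
(`abs_transferKernel_le`) gives `Σ_{j≤k} λ_j² ≤ e^{12B}`; the closed crux ONE at `k = 0` (`oneSiteAbsLower_of_eigenfunctions`, AL1 =
`LuscherHamiltonianEigenfunctions_holds`) and the Gaussian normaliser bound `gauss_le_linkCE` give `λ_0 ≥ ½ e^{6B} √(π/B)⁹ (2π²)^{−3} e^{−a}` with
`a ≤ |ε| + |C|` once `λ_b ≤ 1`. [cite: ReedSimonI1980, Thm. VI.22] [cite: MontvayMunster1994, §3.2.3 (3.97)] [cite: Luscher1983, §1] -/
theorem oneSiteHSRatio : OneSiteHSRatio := by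
  obtain ⟨CA, BA, hAL⟩ := oneSiteAbsLower_of_eigenfunctions (LuscherHamiltonianEigenfunctions_holds 0)
  -- constants
  set a : ℝ := |physLevel (0 + 1)| + |CA| with ha
  refine ⟨4 * ((2 * π ^ 2) ^ 3) ^ 2 / (π ^ 9 * Real.exp (-a) ^ 2), max (max BA 54) 2, fun B hB n => ?_⟩
  have hBA : BA ≤ B := le_trans (le_trans (le_max_left _ _) (le_max_left _ _)) hB
  have hB54 : (54 : ℝ) ≤ B := le_trans (le_trans (le_max_right _ _) (le_max_left _ _)) hB
  have hB2 : (2 : ℝ) ≤ B := le_trans (le_max_right _ _) hB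
  have hBpos : 0 < B := by linarith
  have hBnn : 0 ≤ B := hBpos.le
  have hlampos : 0 < bareLambda B := bareLambda_pos' hBpos
  have hlamle : bareLambda B ≤ 1 := bareLambda_le_of_le one_pos (by norm_num; exact hB2)
  have h0pos : 0 < levelValue su2Rep 1 B 0 := levelValue_zero_su2Rep_pos 1 B
  -- (1) Bessel: `Σ_{j<n} λ_j² ≤ e^{12B}`
  have hM : ∀ U V : GaugeConfig 3 1 SU2, transferKernel su2Rep B U V ≤ Real.exp (2 * B) ^ 3 := by
    intro U V
    have h := abs_transferKernel_le hBnn (U, V)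
    rw [card_edge_one] at h
    exact le_trans (le_abs_self _) h
  have e12 : (Real.exp (2 * B) ^ 3) ^ 2 = Real.exp (12 * B) := by
    rw [← pow_mul, ← Real.exp_nat_mul]; ring_nf
  have hsumsq : ∑ j ∈ Finset.range n, levelValue su2Rep 1 B j ^ 2 ≤ Real.exp (12 * B) := by
    cases n with
    | zero => simp [(Real.exp_pos _).le]
    | succ k =>
      have h := sum_levelValue_sq_le (L := 1) hBpos hM k
      rw [Fin.sum_univ_eq_sum_range (fun j => levelValue su2Rep 1 B j ^ 2) (k + 1), e12] at h
      exact h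
  -- (2) the ground value from below: `ℓ ≤ λ_0`, `ℓ = linkC³ e^{−(ε λ_b) − CA λ_b²}`
  have hℓ : linkC B ^ 3 * Real.exp (-(physLevel (0 + 1) * bareLambda B) - CA * bareLambda B ^ 2) ≤ levelValue su2Rep 1 B 0 := hAL B hBA
  -- (3) Gaussian normaliser: `½ G ≤ linkC³`, `G = e^{6B} √(π/B)⁹/(2π²)³`
  set G : ℝ := Real.exp (6 * B) * Real.sqrt (π / B) ^ 9 / (2 * π ^ 2) ^ 3 with hG
  have hGpos : 0 < G := by positivity
  have hgauss := gauss_le_linkCE hBpos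
  have hlinkCE : linkCE B = linkC B ^ 3 := by rw [linkCE, card_edge_one]
  have h27 : 27 / B ≤ 1 / 2 := by rw [div_le_iff₀ hBpos]; linarith
  have hhalf : (1 : ℝ) / 2 ≤ 1 - 27 / B := by linarith
  have hGle : G / 2 ≤ linkC B ^ 3 := by
    rw [← hlinkCE]
    calc G / 2 = (1 / 2) * G := by ring
      _ ≤ (1 - 27 / B) * G := mul_le_mul_of_nonneg_right hhalf hGpos.le
      _ ≤ linkCE B := hgauss
  -- (4) the exponent: `−(ε λ_b) − CA λ_b² ≥ −a`
  have hexp : Real.exp (-a) ≤ Real.exp (-(physLevel (0 + 1) * bareLambda B) - CA * bareLambda B ^ 2) := by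
    refine Real.exp_le_exp.2 ?_
    have h1 : physLevel (0 + 1) * bareLambda B ≤ |physLevel (0 + 1)| := by
      calc physLevel (0 + 1) * bareLambda B ≤ |physLevel (0 + 1)| * bareLambda B :=
            mul_le_mul_of_nonneg_right (le_abs_self _) hlampos.le
        _ ≤ |physLevel (0 + 1)| * 1 := mul_le_mul_of_nonneg_left hlamle (abs_nonneg _)
        _ = |physLevel (0 + 1)| := mul_one _
    have h2 : CA * bareLambda B ^ 2 ≤ |CA| := by
      have hsq : bareLambda B ^ 2 ≤ 1 := by nlinarith
      calc CA * bareLambda B ^ 2 ≤ |CA| * bareLambda B ^ 2 := mul_le_mul_of_nonneg_right (le_abs_self _) (sq_nonneg _)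
        _ ≤ |CA| * 1 := mul_le_mul_of_nonneg_left hsq (abs_nonneg _)
        _ = |CA| := mul_one _
    rw [ha]; linarith
  -- (5) assemble: `(G/2) e^{−a} ≤ λ_0`, so `e^{12B} ≤ C B⁹ λ_0²`
  have hlow : G / 2 * Real.exp (-a) ≤ levelValue su2Rep 1 B 0 := by
    calc G / 2 * Real.exp (-a) ≤ linkC B ^ 3 * Real.exp (-(physLevel (0 + 1) * bareLambda B) - CA * bareLambda B ^ 2) :=
          mul_le_mul hGle hexp (Real.exp_pos _).le (le_trans (by positivity) hGle)
      _ ≤ levelValue su2Rep 1 B 0 := hℓ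
  have hlow0 : 0 ≤ G / 2 * Real.exp (-a) := by positivity
  have hsqlow : (G / 2 * Real.exp (-a)) ^ 2 ≤ levelValue su2Rep 1 B 0 ^ 2 := pow_le_pow_left₀ hlow0 hlow 2
  have e12' : Real.exp (6 * B) ^ 2 = Real.exp (12 * B) := by
    rw [← Real.exp_nat_mul]; ring_nf
  have hG2 : G ^ 2 = Real.exp (12 * B) * (π ^ 9 / B ^ 9) / ((2 * π ^ 2) ^ 3) ^ 2 := by
    rw [hG, div_pow, mul_pow, sqrt_pow_nine_sq (by positivity), e12', div_pow]
  have hGea : (G / 2 * Real.exp (-a)) ^ 2 = Real.exp (12 * B) * (π ^ 9 / B ^ 9) * Real.exp (-a) ^ 2 / (4 * ((2 * π ^ 2) ^ 3) ^ 2) := by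
    rw [mul_pow, div_pow, hG2]; ring
  have hid : 4 * ((2 * π ^ 2) ^ 3) ^ 2 / (π ^ 9 * Real.exp (-a) ^ 2) * B ^ 9 * (G / 2 * Real.exp (-a)) ^ 2 = Real.exp (12 * B) := by
    rw [hGea]
    have hπ : (π : ℝ) ≠ 0 := Real.pi_pos.ne'
    have hBne : B ≠ 0 := hBpos.ne'
    have hea : Real.exp (-a) ≠ 0 := (Real.exp_pos _).ne'
    field_simp
  have hkey : Real.exp (12 * B) ≤ 4 * ((2 * π ^ 2) ^ 3) ^ 2 / (π ^ 9 * Real.exp (-a) ^ 2) * B ^ 9 * levelValue su2Rep 1 B 0 ^ 2 := by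
    rw [← hid]
    exact mul_le_mul_of_nonneg_left hsqlow (by positivity)
  -- (6) conclude
  have hdiv : ∑ j ∈ Finset.range n, (levelValue su2Rep 1 B j / levelValue su2Rep 1 B 0) ^ 2
      = (∑ j ∈ Finset.range n, levelValue su2Rep 1 B j ^ 2) / levelValue su2Rep 1 B 0 ^ 2 := by
    rw [Finset.sum_div]
    refine Finset.sum_congr rfl fun j _ => ?_
    rw [div_pow]
  rw [hdiv, div_le_iff₀ (pow_pos h0pos 2)]
  exact hsumsq.trans hkey

/-! ## §2 (TD) truncated domination — the femto-zone hypothesis (WEAKER than the owner's `OneSiteDomination`) -/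

/-- **`OneSiteTruncatedDomination`** (door 2, input 2): for every height `c₁ > 0` a Laplace-summable profile `g ≥ 0` and a threshold `B0` with
`λ_k(B) ≤ e^{−λ_b(B)·min(g(k), c₁ log B)} λ_0(B)` for all `k` and all `B ≥ B0` — domination of the one-site zero-flux levels only up to femto
energy `c₁ log B` (the count of levels below `E ≤ c₁ log B`), the threshold value beyond. [cite: Luscher1983, §1] [cite: Simon1983, Thm 1.1]
[cite: ReedSimonIV1978, Thm. XIII.1] -/
def OneSiteTruncatedDomination : Prop :=
  ∀ c₁ : ℝ, 0 < c₁ → ∃ g : ℕ → ℝ, (∀ k, 0 ≤ g k) ∧ (∀ t : ℝ, 0 < t → Summable fun k : ℕ => Real.exp (-t * g k)) ∧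
    ∃ B0 : ℝ, ∀ B : ℝ, B0 ≤ B → ∀ k : ℕ,
      levelValue su2Rep 1 B k ≤ Real.exp (-(bareLambda B * min (g k) (c₁ * Real.log B))) * levelValue su2Rep 1 B 0

/-- Door 1's hypothesis implies door 2's: `OneSiteDomination → OneSiteTruncatedDomination` (`min(g, c₁ log B) ≤ g`). [folklore] -/
theorem truncatedDomination_of_domination (h : OneSiteDomination) : OneSiteTruncatedDomination := by
  obtain ⟨g, hg0, hgsum, B0, hdom⟩ := h
  intro c₁ _
  refine ⟨g, hg0, hgsum, max B0 1, fun B hB k => ?_⟩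
  have hB0 : B0 ≤ B := le_trans (le_max_left _ _) hB
  have hB1 : (1 : ℝ) ≤ B := le_trans (le_max_right _ _) hB
  have hBpos : 0 < B := by linarith
  have h0nn : 0 ≤ levelValue su2Rep 1 B 0 := levelValue_su2Rep_nonneg 1 hBpos.le 0
  refine (hdom B hB0 k).trans (mul_le_mul_of_nonneg_right (Real.exp_le_exp.2 ?_) h0nn)
  have hlam : 0 ≤ bareLambda B := (bareLambda_pos' hBpos).le
  have : bareLambda B * min (g k) (c₁ * Real.log B) ≤ bareLambda B * g k := mul_le_mul_of_nonneg_left (min_le_left _ _) hlam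
  linarith

/-! ## §3 ★ door 2 closes the item: `OneSiteHSRatio → OneSiteTruncatedDomination → OneSiteTail` -/

/-- Real-analysis core of the glue: a pointwise majorant `u ≤ a + v·D` with `a` summable of small `K`-tail and `v ≥ 0` of bounded partial sums gives
`u` summable with `Σ_k u_{k+K} ≤ ε₁ + S·D`. [folklore] -/
theorem tail_le_of_majorant {u a v : ℕ → ℝ} {D ε₁ S : ℝ} (K : ℕ)
    (hu0 : ∀ k, 0 ≤ u k) (hmaj : ∀ k, u k ≤ a k + v k * D) (hD : 0 ≤ D)
    (ha : Summable a) (haK : ∑' k, a (k + K) ≤ ε₁)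
    (hv0 : ∀ k, 0 ≤ v k) (hv : ∀ n, ∑ j ∈ Finset.range n, v j ≤ S) :
    Summable u ∧ ∑' k, u (k + K) ≤ ε₁ + S * D := by
  have hvs : Summable v := summable_of_sum_range_le hv0 hv
  have hm : Summable (fun k => a k + v k * D) := ha.add (hvs.mul_right D)
  have hus : Summable u := Summable.of_nonneg_of_le hu0 hmaj hm
  refine ⟨hus, ?_⟩
  have h1 : ∑' k, u (k + K) ≤ ∑' k, (a (k + K) + v (k + K) * D) :=
    Summable.tsum_le_tsum (fun k => hmaj (k + K)) ((summable_nat_add_iff K).2 hus) ((summable_nat_add_iff K).2 hm)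
  have h2 : ∑' k, (a (k + K) + v (k + K) * D) = ∑' k, a (k + K) + (∑' k, v (k + K)) * D := by
    rw [Summable.tsum_add ((summable_nat_add_iff K).2 ha) (((summable_nat_add_iff K).2 hvs).mul_right D), tsum_mul_right]
  have h3 : ∑' k, v (k + K) ≤ S := by
    have h := hvs.sum_add_tsum_nat_add K
    have hnn : 0 ≤ ∑ i ∈ Finset.range K, v i := Finset.sum_nonneg fun i _ => hv0 i
    have hvt : ∑' k, v k ≤ S := Real.tsum_le_of_sum_range_le hv0 hv
    linarith
  calc ∑' k, u (k + K) ≤ ∑' k, (a (k + K) + v (k + K) * D) := h1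
    _ = ∑' k, a (k + K) + (∑' k, v (k + K)) * D := h2
    _ ≤ ε₁ + S * D := add_le_add haK (mul_le_mul_of_nonneg_right h3 hD)

/-- ★ **Door 2**: `OneSiteHSRatio → OneSiteTruncatedDomination → OneSiteTail` (body verbatim).  Given `s, ε`: height `c₁ := 40/s`; for `B` large
`λ_b ≤ s/8`, so `Tλ_b ≥ s/2` forces `T ≥ 4` and `(T−2)λ_b ≥ s/4`; covered levels (`g(k) ≤ c₁ log B`) give `x_k^T ≤ e^{−(s/2)g(k)}`, the others
`x_k^T = x_k²·x_k^{T−2} ≤ x_k²·B^{−10}`; sum with (HS): `Σ_{k≥K} x_k^T ≤ ε/2 + C B⁹/B^{10} ≤ ε`. [cite: Luscher1983, §1] [cite: Simon1983, Thm 1.1] -/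
theorem oneSiteTail_of_hs_truncated (hHS : OneSiteHSRatio) (hTD : OneSiteTruncatedDomination) : OneSiteTailBody := by
  obtain ⟨C, B1, hC⟩ := hHS
  intro s hs ε hε
  have hsne : s ≠ 0 := hs.ne'
  -- the profile at height `c₁ = 40/s`
  obtain ⟨g, hg0, hgsum, B0, hdom⟩ := hTD (40 / s) (by positivity)
  have hG : Summable (fun k => Real.exp (-(s / 2) * g k)) := hgsum _ (by positivity)
  have hGtail : ∀ᶠ i : ℕ in atTop, ∑' k, Real.exp (-(s / 2) * g (k + i)) < ε / 2 :=
    (tendsto_sum_nat_add (fun k => Real.exp (-(s / 2) * g k))).eventually (eventually_lt_nhds (by positivity))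
  obtain ⟨K, hK⟩ := Filter.eventually_atTop.1 hGtail
  -- the threshold in `B`
  set C' : ℝ := max C 0 with hC'
  have hCle : C ≤ C' := le_max_left _ _
  have hC'nn : 0 ≤ C' := le_max_right _ _
  refine ⟨K, max (max B0 B1) (max (2 / (s / 8) ^ 3) (max (2 * C' / ε + 1) 1)), fun B hB T hT => ?_⟩
  have hB0 : B0 ≤ B := le_trans (le_trans (le_max_left _ _) (le_max_left _ _)) hB
  have hB1 : B1 ≤ B := le_trans (le_trans (le_max_right _ _) (le_max_left _ _)) hB
  have hBs : 2 / (s / 8) ^ 3 ≤ B := le_trans (le_trans (le_max_left _ _) (le_max_right _ _)) hB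
  have hBC : 2 * C' / ε + 1 ≤ B :=
    le_trans (le_trans (le_trans (le_max_left _ _) (le_max_right _ _)) (le_max_right _ _)) hB
  have hBone : (1 : ℝ) ≤ B :=
    le_trans (le_trans (le_trans (le_max_right _ _) (le_max_right _ _)) (le_max_right _ _)) hB
  have hBpos : 0 < B := by linarith
  have hBnn : 0 ≤ B := hBpos.le
  have hlogB : 0 ≤ Real.log B := Real.log_nonneg hBone
  have hlam8 : bareLambda B ≤ s / 8 := bareLambda_le_of_le (by positivity) hBs
  have h0pos : 0 < levelValue su2Rep 1 B 0 := levelValue_zero_su2Rep_pos 1 B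
  have hB10 : 0 < B ^ 10 := by positivity
  -- the ratios `x_k ∈ [0, 1]` and the truncated domination in ratio form
  have hx0 : ∀ k, 0 ≤ levelValue su2Rep 1 B k / levelValue su2Rep 1 B 0 := fun k =>
    div_nonneg (levelValue_su2Rep_nonneg 1 hBnn k) h0pos.le
  have hxdom : ∀ k, levelValue su2Rep 1 B k / levelValue su2Rep 1 B 0 ≤ Real.exp (-(bareLambda B * min (g k) (40 / s * Real.log B))) :=
    fun k => by rw [div_le_iff₀ h0pos]; exact hdom B hB0 k
  -- `T ≥ 4` and `(T − 2) λ_b ≥ s/4`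
  have hTl : s / 2 ≤ (T : ℝ) * bareLambda B := by linarith
  have hT4 : (4 : ℝ) ≤ T := by
    by_contra h
    push Not at h
    have h' : (T : ℝ) * bareLambda B < 4 * (s / 8) :=
      calc (T : ℝ) * bareLambda B ≤ (T : ℝ) * (s / 8) := mul_le_mul_of_nonneg_left hlam8 (Nat.cast_nonneg T)
        _ < 4 * (s / 8) := mul_lt_mul_of_pos_right h (by positivity)
    linarith
  have hT4n : 4 ≤ T := by exact_mod_cast hT4
  have hT2l : s / 4 ≤ ((T : ℝ) - 2) * bareLambda B := by
    have : ((T : ℝ) - 2) * bareLambda B = (T : ℝ) * bareLambda B - 2 * bareLambda B := by ring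
    linarith
  have hcast : (((T - 2 : ℕ) : ℝ)) = (T : ℝ) - 2 := by
    have h2T : 2 ≤ T := by omega
    push_cast [h2T]; ring
  have hBlog : Real.exp (10 * Real.log B) = B ^ 10 := by
    rw [← Real.exp_log hB10, Real.log_pow]; norm_num
  -- the pointwise majorant `x_k^T ≤ e^{−(s/2) g(k)} + x_k² · B^{−10}`
  have hmaj : ∀ k, (levelValue su2Rep 1 B k / levelValue su2Rep 1 B 0) ^ T
      ≤ Real.exp (-(s / 2) * g k) + (levelValue su2Rep 1 B k / levelValue su2Rep 1 B 0) ^ 2 * (B ^ 10)⁻¹ := by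
    intro k
    rcases le_total (g k) (40 / s * Real.log B) with hgk | hgk
    · -- covered level: `min = g k`
      have hxk : levelValue su2Rep 1 B k / levelValue su2Rep 1 B 0 ≤ Real.exp (-(bareLambda B * g k)) := by
        have h := hxdom k; rwa [min_eq_left hgk] at h
      have h1 : (levelValue su2Rep 1 B k / levelValue su2Rep 1 B 0) ^ T ≤ Real.exp (-(s / 2) * g k) :=
        calc (levelValue su2Rep 1 B k / levelValue su2Rep 1 B 0) ^ T ≤ Real.exp (-(bareLambda B * g k)) ^ T :=
              pow_le_pow_left₀ (hx0 k) hxk T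
          _ = Real.exp (-((T : ℝ) * bareLambda B) * g k) := by rw [← Real.exp_nat_mul]; congr 1; ring
          _ ≤ Real.exp (-(s / 2) * g k) := by
              refine Real.exp_le_exp.2 ?_
              have := mul_le_mul_of_nonneg_right hTl (hg0 k)
              linarith
      have h2 : 0 ≤ (levelValue su2Rep 1 B k / levelValue su2Rep 1 B 0) ^ 2 * (B ^ 10)⁻¹ := by positivity
      linarith
    · -- level beyond the height: `min = c₁ log B`, split `x^T = x² · x^{T−2}`
      have hxk : levelValue su2Rep 1 B k / levelValue su2Rep 1 B 0 ≤ Real.exp (-(bareLambda B * (40 / s * Real.log B))) := by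
        have h := hxdom k; rwa [min_eq_right hgk] at h
      have hsplit : (levelValue su2Rep 1 B k / levelValue su2Rep 1 B 0) ^ T
          = (levelValue su2Rep 1 B k / levelValue su2Rep 1 B 0) ^ 2 * (levelValue su2Rep 1 B k / levelValue su2Rep 1 B 0) ^ (T - 2) := by
        rw [← pow_add]; congr 1; omega
      have hpow : (levelValue su2Rep 1 B k / levelValue su2Rep 1 B 0) ^ (T - 2) ≤ (B ^ 10)⁻¹ :=
        calc (levelValue su2Rep 1 B k / levelValue su2Rep 1 B 0) ^ (T - 2)
            ≤ Real.exp (-(bareLambda B * (40 / s * Real.log B))) ^ (T - 2) := pow_le_pow_left₀ (hx0 k) hxk (T - 2)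
          _ = Real.exp (-((((T - 2 : ℕ) : ℝ)) * bareLambda B) * (40 / s * Real.log B)) := by
              rw [← Real.exp_nat_mul]; congr 1; ring
          _ ≤ Real.exp (-(10 * Real.log B)) := by
              refine Real.exp_le_exp.2 ?_
              rw [hcast]
              have hA : s / 4 * (40 / s * Real.log B) ≤ ((T : ℝ) - 2) * bareLambda B * (40 / s * Real.log B) :=
                mul_le_mul_of_nonneg_right hT2l (mul_nonneg (by positivity) hlogB)
              have h40 : s / 4 * (40 / s * Real.log B) = 10 * Real.log B := by field_simp; ring
              linarith
          _ = (B ^ 10)⁻¹ := by rw [Real.exp_neg, hBlog]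
      have h1 : (levelValue su2Rep 1 B k / levelValue su2Rep 1 B 0) ^ T
          ≤ (levelValue su2Rep 1 B k / levelValue su2Rep 1 B 0) ^ 2 * (B ^ 10)⁻¹ := by
        rw [hsplit]; exact mul_le_mul_of_nonneg_left hpow (sq_nonneg _)
      have h2 : 0 ≤ Real.exp (-(s / 2) * g k) := (Real.exp_pos _).le
      linarith
  -- (HS) partial sums, and the conclusion via `tail_le_of_majorant`
  have hsq : ∀ n, ∑ j ∈ Finset.range n, (levelValue su2Rep 1 B j / levelValue su2Rep 1 B 0) ^ 2 ≤ C' * B ^ 9 := fun n =>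
    (hC B hB1 n).trans (mul_le_mul_of_nonneg_right hCle (by positivity))
  obtain ⟨hsumT, htail⟩ := tail_le_of_majorant (u := fun k => (levelValue su2Rep 1 B k / levelValue su2Rep 1 B 0) ^ T)
    (a := fun k => Real.exp (-(s / 2) * g k)) (v := fun k => (levelValue su2Rep 1 B k / levelValue su2Rep 1 B 0) ^ 2)
    K (fun k => pow_nonneg (hx0 k) T) hmaj (inv_nonneg.2 hB10.le) hG (hK K le_rfl).le (fun k => sq_nonneg _) hsq
  refine ⟨hsumT, htail.trans ?_⟩
  -- `ε/2 + C' B⁹ · B^{−10} ≤ ε`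
  have hfrac : C' * B ^ 9 * (B ^ 10)⁻¹ ≤ ε / 2 := by
    have hBgt : 2 * C' / ε < B := by linarith
    have hBne : B ≠ 0 := hBpos.ne'
    have h1 : C' * B ^ 9 * (B ^ 10)⁻¹ = C' / B := by field_simp
    rw [h1, div_le_iff₀ hBpos]
    have h2 := (div_lt_iff₀ hε).1 hBgt
    linarith
  linarith

/-- ★ Hence door 2 needs ONLY the truncated domination: `OneSiteTruncatedDomination → OneSiteTail` (body verbatim). [cite: Luscher1983, §1] -/
theorem oneSiteTail_of_truncatedDomination (hTD : OneSiteTruncatedDomination) : OneSiteTailBody :=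
  oneSiteTail_of_hs_truncated oneSiteHSRatio hTD

/-- … and door 1 is a special case: `OneSiteDomination → OneSiteTail` (the owner's `OSTail.oneSiteTail_of_domination`, re-derived through door 2).
[cite: Luscher1983, §1] -/
theorem oneSiteTail_of_domination' (h : OneSiteDomination) : OneSiteTailBody :=
  oneSiteTail_of_truncatedDomination (truncatedDomination_of_domination h)

/-! ## §4 The currency of (TD): a femto-zone LEVEL COUNT, and its variational («no intruders») form

`OneSiteFemtoSubspaceBound → OneSiteLowCount → OneSiteTruncatedDomination` (both arrows PROVED), so the M-seat may aim at either:
the count `N_B(E) ≤ C(1+E)^p` of one-site zero-flux levels of femto energy `≤ E`, for `0 ≤ E ≤ c₁ log B`, uniformly in `B ≥ B0(c₁)` — in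
level form (`OneSiteLowCount`) or as `n ≤ C(1+E)^p` physical constraint functions killing every Rayleigh quotient above `e^{−λ_b E} λ_0`
(`OneSiteFemtoSubspaceBound`, the hypothesis shape of the tree door `levelValue_le_of_forall_rayleigh_le`). -/

/-- **`OneSiteLowCount`** (femto-zone Weyl-type upper count, level form): for every height `c₁ > 0` there are `C > 0`, `p`, `B0` such that
for `B ≥ B0`, every femto energy `0 ≤ E ≤ c₁ log B` and every level index `k ≥ C(1+E)^p`: `λ_k(B) ≤ e^{−λ_b(B) E} λ_0(B)` — i.e. the
number of one-site zero-flux transfer levels above `e^{−λ_b E} λ_0` is at most `C(1+E)^p`, uniformly in `B` on the femto zone.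
[cite: Luscher1983, §1] [cite: Simon1983, Thm 1.1] [cite: ReedSimonIV1978, Thm. XIII.1] -/
def OneSiteLowCount : Prop :=
  ∀ c₁ : ℝ, 0 < c₁ → ∃ C : ℝ, ∃ p : ℕ, ∃ B0 : ℝ, 0 < C ∧ ∀ B : ℝ, B0 ≤ B → ∀ E : ℝ, 0 ≤ E → E ≤ c₁ * Real.log B →
    ∀ k : ℕ, C * (1 + E) ^ p ≤ (k : ℝ) →
      levelValue su2Rep 1 B k ≤ Real.exp (-(bareLambda B * E)) * levelValue su2Rep 1 B 0

/-- **`OneSiteFemtoSubspaceBound`** (the same count in the variational currency of the «no intruders» door): for `B ≥ B0` and every femto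
energy `0 ≤ E ≤ c₁ log B` there are `n ≤ C(1+E)^p` physical zero-flux constraint functions `φ_i` on `SU(2)³` such that every physical `ψ`
with `⟨ψ, φ_i⟩ = 0` (all `i`) and `‖ψ‖² > 0` has `⟨ψ, K_B ψ⟩ ≤ e^{−λ_b(B) E} λ_0(B) ‖ψ‖²` (IMS localisation along the toron valley + the
matrix-model bound on the number of femto levels below `E`). [cite: Luscher1983, §1] [cite: Simon1983, Thm 1.1] [cite: ReedSimonIV1978, Thm. XIII.1] -/
def OneSiteFemtoSubspaceBound : Prop :=
  ∀ c₁ : ℝ, 0 < c₁ → ∃ C : ℝ, ∃ p : ℕ, ∃ B0 : ℝ, 0 < C ∧ ∀ B : ℝ, B0 ≤ B → ∀ E : ℝ, 0 ≤ E → E ≤ c₁ * Real.log B →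
    ∃ n : ℕ, (n : ℝ) ≤ C * (1 + E) ^ p ∧ ∃ φs : Fin n → (GaugeConfig 3 1 SU2 → ℝ), (∀ i, IsPhys (φs i)) ∧
      ∀ ψ : GaugeConfig 3 1 SU2 → ℝ, IsPhys ψ → (∀ i, l2 ψ (φs i) = 0) → 0 < l2 ψ ψ →
        qform su2Rep B ψ ψ ≤ (Real.exp (-(bareLambda B * E)) * levelValue su2Rep 1 B 0) * l2 ψ ψ

/-- Subspace form ⇒ level form, through the tree door `levelValue_le_of_forall_rayleigh_le` and monotonicity in the level.
[cite: ReedSimonIV1978, Thm. XIII.1] -/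
theorem lowCount_of_femtoSubspaceBound (h : OneSiteFemtoSubspaceBound) : OneSiteLowCount := by
  intro c₁ hc₁
  obtain ⟨C, p, B0, hC, hB⟩ := h c₁ hc₁
  refine ⟨C, p, max B0 1, hC, fun B hBB E hE0 hE k hk => ?_⟩
  have hB0 : B0 ≤ B := le_trans (le_max_left _ _) hBB
  have hB1 : (1 : ℝ) ≤ B := le_trans (le_max_right _ _) hBB
  have hBpos : 0 < B := by linarith
  obtain ⟨n, hn, φs, hφ, hray⟩ := hB B hB0 E hE0 hE
  have hs0 : 0 ≤ Real.exp (-(bareLambda B * E)) * levelValue su2Rep 1 B 0 :=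
    mul_nonneg (Real.exp_pos _).le (levelValue_su2Rep_nonneg 1 hBpos.le 0)
  have hn' : levelValue su2Rep 1 B n ≤ Real.exp (-(bareLambda B * E)) * levelValue su2Rep 1 B 0 :=
    levelValue_le_of_forall_rayleigh_le su2Rep B hs0 φs hφ hray
  have hnk' : (n : ℝ) ≤ k := hn.trans hk
  have hnk : n ≤ k := by exact_mod_cast hnk'
  exact (levelValue_le_of_le hBpos hnk).trans hn'

/-- The stretched-exponential bound behind the Laplace summability of the inverse profile `g(n) = (n/C)^{1/p} − 1`:
`e^{−t((n/C)^{1/p} − 1)} ≤ e^t (2p)! C² t^{−2p} / n²` (`n ≥ 1`), from `x^m/m! ≤ e^x`. [folklore] -/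
theorem exp_neg_rpow_inv_le {C t : ℝ} (hC : 0 < C) (ht : 0 < t) (p : ℕ) (hp : p ≠ 0) (n : ℕ) (hn : 1 ≤ n) :
    Real.exp (-t * (((n : ℝ) / C) ^ ((p : ℝ)⁻¹) - 1))
      ≤ Real.exp t * (((2 * p).factorial : ℝ) * C ^ 2 / t ^ (2 * p)) * ((n : ℝ) ^ 2)⁻¹ := by
  set y : ℝ := ((n : ℝ) / C) ^ ((p : ℝ)⁻¹) with hy
  have hnpos : (0 : ℝ) < n := by
    have h : 0 < n := by omega
    exact_mod_cast h
  have hnC : 0 < (n : ℝ) / C := div_pos hnpos hC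
  have hypos : 0 < y := Real.rpow_pos_of_pos hnC _
  have hyp : y ^ p = (n : ℝ) / C := Real.rpow_inv_natCast_pow hnC.le hp
  have hty : 0 < t * y := mul_pos ht hypos
  have h1 : Real.exp (-t * (y - 1)) = Real.exp t * Real.exp (-(t * y)) := by
    rw [← Real.exp_add]; congr 1; ring
  have h2 : Real.exp (-(t * y)) ≤ ((2 * p).factorial : ℝ) / (t * y) ^ (2 * p) := by
    have hfac := Real.pow_div_factorial_le_exp (t * y) hty.le (2 * p)
    have hpos : 0 < (t * y) ^ (2 * p) / ((2 * p).factorial : ℝ) := by positivity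
    rw [Real.exp_neg]
    calc (Real.exp (t * y))⁻¹ ≤ ((t * y) ^ (2 * p) / ((2 * p).factorial : ℝ))⁻¹ := inv_anti₀ hpos hfac
      _ = ((2 * p).factorial : ℝ) / (t * y) ^ (2 * p) := by rw [inv_div]
  have h3 : (t * y) ^ (2 * p) = t ^ (2 * p) * ((n : ℝ) ^ 2 / C ^ 2) := by
    rw [mul_pow, pow_mul' y 2 p, hyp, div_pow]
  have h4 : ((2 * p).factorial : ℝ) / (t * y) ^ (2 * p) = (((2 * p).factorial : ℝ) * C ^ 2 / t ^ (2 * p)) * ((n : ℝ) ^ 2)⁻¹ := by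
    rw [h3]
    have htne : t ≠ 0 := ht.ne'
    have hnne : (n : ℝ) ≠ 0 := hnpos.ne'
    have hCne : C ≠ 0 := hC.ne'
    field_simp
  calc Real.exp (-t * (y - 1)) = Real.exp t * Real.exp (-(t * y)) := h1
    _ ≤ Real.exp t * (((2 * p).factorial : ℝ) / (t * y) ^ (2 * p)) := mul_le_mul_of_nonneg_left h2 (Real.exp_pos t).le
    _ = Real.exp t * (((2 * p).factorial : ℝ) * C ^ 2 / t ^ (2 * p)) * ((n : ℝ) ^ 2)⁻¹ := by rw [h4]; ring

/-- ★ **Count ⇒ truncated domination**: `OneSiteLowCount → OneSiteTruncatedDomination`, with the inverse profile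
`g(k) = max(0, (k/C)^{1/(p+1)} − 1)` (Laplace-summable by `exp_neg_rpow_inv_le` and `Σ 1/n² < ∞`). [folklore] [cite: Simon1983, Thm 1.1] -/
theorem truncatedDomination_of_lowCount (h : OneSiteLowCount) : OneSiteTruncatedDomination := by
  intro c₁ hc₁
  obtain ⟨C, p, B0, hC, hcount⟩ := h c₁ hc₁
  set q : ℕ := p + 1 with hq
  have hq0 : q ≠ 0 := Nat.succ_ne_zero p
  let g : ℕ → ℝ := fun k => max 0 (((k : ℝ) / C) ^ ((q : ℝ)⁻¹) - 1)
  refine ⟨g, fun k => le_max_left _ _, fun t ht => ?_, max B0 1, fun B hB k => ?_⟩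
  · -- Laplace summability of the profile
    set M : ℝ := Real.exp t * (((2 * q).factorial : ℝ) * C ^ 2 / t ^ (2 * q)) with hM
    have hbound : ∀ k : ℕ, Real.exp (-t * g (k + 1)) ≤ M * ((((k + 1 : ℕ) : ℝ)) ^ 2)⁻¹ := by
      intro k
      have hgk : ((((k + 1 : ℕ) : ℝ)) / C) ^ ((q : ℝ)⁻¹) - 1 ≤ g (k + 1) := le_max_right _ _
      calc Real.exp (-t * g (k + 1)) ≤ Real.exp (-t * (((((k + 1 : ℕ) : ℝ)) / C) ^ ((q : ℝ)⁻¹) - 1)) := by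
            refine Real.exp_le_exp.2 ?_
            have := mul_le_mul_of_nonneg_left hgk ht.le
            linarith
        _ ≤ M * ((((k + 1 : ℕ) : ℝ)) ^ 2)⁻¹ := exp_neg_rpow_inv_le hC ht q hq0 (k + 1) (by omega)
    have hmaj : Summable (fun k : ℕ => M * ((((k + 1 : ℕ) : ℝ)) ^ 2)⁻¹) := by
      have hs : Summable (fun n : ℕ => M * (((n : ℝ)) ^ 2)⁻¹) := (Real.summable_nat_pow_inv.2 (by norm_num)).mul_left M
      exact (summable_nat_add_iff 1).2 hs
    have hshift : Summable (fun k : ℕ => Real.exp (-t * g (k + 1))) :=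
      Summable.of_nonneg_of_le (fun k => (Real.exp_pos _).le) hbound hmaj
    exact (summable_nat_add_iff 1).1 hshift
  · -- truncated domination from the count
    have hB0 : B0 ≤ B := le_trans (le_max_left _ _) hB
    have hB1 : (1 : ℝ) ≤ B := le_trans (le_max_right _ _) hB
    have hBpos : 0 < B := by linarith
    have hlogB : 0 ≤ c₁ * Real.log B := mul_nonneg hc₁.le (Real.log_nonneg hB1)
    have hkC : 0 ≤ (k : ℝ) / C := div_nonneg (Nat.cast_nonneg k) hC.le
    set y : ℝ := ((k : ℝ) / C) ^ ((q : ℝ)⁻¹) with hy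
    have hyq : y ^ q = (k : ℝ) / C := Real.rpow_inv_natCast_pow hkC hq0
    have hgk : g k = max 0 (y - 1) := rfl
    rcases le_total y 1 with hy1 | hy1
    · -- `g k = 0`: the claim is `λ_k ≤ λ_0`
      have hg0 : g k = 0 := by rw [hgk]; exact max_eq_left (by linarith)
      have hmin : min (g k) (c₁ * Real.log B) = 0 := by rw [hg0]; exact min_eq_left hlogB
      rw [hmin, mul_zero, neg_zero, Real.exp_zero, one_mul]
      exact levelValue_le_of_le hBpos (Nat.zero_le k)
    · -- `g k = y − 1 ≥ 0`: the count at femto energy `E = min (g k) (c₁ log B)`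
      have hgk' : g k = y - 1 := by rw [hgk]; exact max_eq_right (by linarith)
      set m : ℝ := min (g k) (c₁ * Real.log B) with hm
      have hm0 : 0 ≤ m := le_min (le_max_left _ _) hlogB
      have hmle : m ≤ c₁ * Real.log B := min_le_right _ _
      have hmg : m ≤ g k := min_le_left _ _
      have h1m : 1 + m ≤ y := by linarith
      have hpow : (1 + m) ^ q ≤ (k : ℝ) / C := by
        rw [← hyq]; exact pow_le_pow_left₀ (by linarith) h1m q
      have hkq : C * (1 + m) ^ q ≤ (k : ℝ) := by
        have h1 := mul_le_mul_of_nonneg_left hpow hC.le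
        have h2 : C * ((k : ℝ) / C) = k := by field_simp
        linarith
      have hkp : C * (1 + m) ^ p ≤ (k : ℝ) := by
        refine le_trans (mul_le_mul_of_nonneg_left ?_ hC.le) hkq
        exact pow_le_pow_right₀ (by linarith) (Nat.le_succ p)
      exact hcount B hB0 m hm0 hmle k hkp

/-- ★ `OneSiteLowCount → OneSiteTail` (body verbatim). [cite: Luscher1983, §1] -/
theorem oneSiteTail_of_lowCount (h : OneSiteLowCount) : OneSiteTailBody :=
  oneSiteTail_of_truncatedDomination (truncatedDomination_of_lowCount h)

/-- ★ `OneSiteFemtoSubspaceBound → OneSiteTail` (body verbatim): the operator-side target for the M-seat on stmt-QuantumFields-20204.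
[cite: Luscher1983, §1] [cite: ReedSimonIV1978, Thm. XIII.1] -/
theorem oneSiteTail_of_femtoSubspaceBound (h : OneSiteFemtoSubspaceBound) : OneSiteTailBody :=
  oneSiteTail_of_lowCount (lowCount_of_femtoSubspaceBound h)

end Summit.QuantumFields.YangMills.Theorems.FemtoTransferGap.OSTailDoors

end
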